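import Mathlib
import HarnessLib
import HarnessLib.Audit
import Summits.MatrixMultiplication.Statement
import Literature.Computability.AlgebraicComplexity.AsymptoticSpectrum
import Literature.Computability.AlgebraicComplexity.MatrixMultiplicationExponent
import Literature.Computability.AlgebraicComplexity.TensorRankFactsProofs
import HarnessLib.Audit.Status.Attr

/-!
Route: SchurWeylEquivariant

DORMANT since 2026-08-22T03:34:30Z (reconciler: no traction for 5 d (last activity item-evidence-added at 2026-08-17T02:17:15Z); parked, not closed — `ledger route dormant route-MatrixMultiplication-SchurWeylEquivariant --off` to reacti) — unstaffed, not closed; items shared with open routes are served there. `ledger route dormant <id> --off` reactivates.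

# Route SchurWeylEquivariant — S_N-equivariant decompositions of Kronecker powers of <2,2,2> have
exponent two (equivariant asymptotic rank = 4)

X (EQUIVARIANT ASYMPTOTIC RANK OF <2,2,2> IS 4; realises card schur-weyl-equivariant-kronecker, its
only card). Let
T_N := <2,2,2>^{⊠N} = kroneckerPow (matMulTensor ℂ 2 2 2) N (≅ <2^N,2^N,2^N>; legs indexed by Fin N
→ Fin 2 × Fin 2), on which S_N acts by
permuting the N Kronecker positions simultaneously in the three legs (a ↦ a ∘ σ). A decomposition of
T_N into r triads is S_N-EQUIVARIANT if
its multiset of triads is S_N-stable (for every σ a permutation π of the r labels with triad(π j) =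
σ·triad(j)); R^eq_N := least such r.
X: for every ε > 0 there is an N ≥ 1 with R^eq_N ≤ 4^{(1+ε)N}. It suffices: R(<2^N,2^N,2^N>) =
R(T_N) ≤ R^eq_N and R~(<2,2,2>) = 2^ω
(asymptoticRank_matMulTensor, proved) give ω ≤ 2 + 2ε for every ε, and ω ≥ 2 (two_le_omega, proved).
One N per ε is equivalent to the
liminf form lim inf_N (R^eq_N)^{1/N} = 4 because R(T_N) > 4^N forces N → ∞ as ε → 0. The
equivariance predicate is inlined (no new definition).
Lean: `∀ ε : ℝ, 0 < ε → ∃ N : ℕ, 1 ≤ N ∧ ∃ r : ℕ, (r : ℝ) ≤ (4 : ℝ) ^ ((1 + ε) * N) ∧ ∃ (w u v : Fin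
r → (Fin N → Fin 2 × Fin 2) → ℂ), Literature.Computability.AlgebraicComplexity.kroneckerPow
(Literature.Computability.AlgebraicComplexity.matMulTensor ℂ 2 2 2) N = ∑ j,
Literature.Computability.AlgebraicComplexity.triad (w j) (u j) (v j) ∧ ∀ σ : Equiv.Perm (Fin N), ∃ π
: Equiv.Perm (Fin r), ∀ j, Literature.Computability.AlgebraicComplexity.triad (w (π j)) (u (π j)) (v
(π j)) = fun a b c => Literature.Computability.AlgebraicComplexity.triad (w j) (u j) (v j) (a ∘ σ)
(b ∘ σ) (c ∘ σ)`

## Assembly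
Provable now from the cone (ε-bookkeeping only): given ε, X yields N ≥ 1 and an equivariant
decomposition with r ≤ 4^{(1+ε)N} triads;
R(T_N) ≤ r (tensorRank_le_of_eq_sum); asymptoticRank (matMulTensor ℂ 2 2 2) ≤ R(T_N)^{1/N} (the N-th
term of the defining infimum) ≤ 4^{1+ε};
asymptoticRank_matMulTensor: R~(<2,2,2>) = 2^{ω(ℂ)}, so ω ≤ 2 + 2ε for every ε > 0, hence ω ≤ 2;
with two_le_omega (Theorems/AsymptoticSpectrumOmegaGeTwo)
ω(ℂ) = 2 = MatrixMultiplication. (Alternatively via EquivariantRankBound and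
Literature.CplxAlg.mem_admissibleExponents_of_pow_two.)

Rationale: WHY THIS LINE. Every known near-optimal decomposition of T_N is a Kronecker product D^{⊠N} of a
decomposition D of <2,2,2> and is therefore already
S_N-equivariant (Strassen: R^eq_N ≤ 7^N; standard: 8^N), so R^eq interpolates between what we have
(7^N) and what ω = 2 needs (4^{(1+o(1))N})
while collapsing the search space: an orbit of a triad with stabiliser H has [S_N : H] terms, orbits
of size ≤ 4^{(1+ε)N} force huge
stabilisers, hence (large-subgroup theorems for S_N) Young-type stabilisers with few blocks and
Young-symmetric legs w ∈ ⊗_i Sym^{λ_i}(ℂ^4)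
(Schur–Weyl), and the identity "sum of orbit-sums = T_N" lives in the S_N-invariants
((ℂ^64)^{⊗N})^{S_N} ≅ Sym^N(ℂ^64) of dimension
C(N+63,63) = poly(N): equivalently T_N = Reynolds(S) for a tensor S of rank = number of orbits
(Str^{⊠N} = Rey(Σ_{m ⊢_7 N} C(N;m) t^m)).
Imported areas: representation theory of S_N × GL_4 (Schur–Weyl duality, Kronecker/plethysm
coefficients), finite permutation groups
(index bounds), computer algebra of decompositions with prescribed symmetry (isotropy stabilisers
arXiv:2506.13242 §3, flip graphs with
symmetry arXiv:2502.04514, orbit flip graphs arXiv:2503.05467). Sources: LandsbergGCT2017 §4.1 (Def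
4.1.2.1, Prop 4.1.2.2, Q 4.1.4.2,
Conj 4.1.4.3 = BILR arXiv:1801.00843), CILO arXiv:1610.08364, Burichenko arXiv:1408.6273,
Grochow–Moore arXiv:1612.01527, Cohn–Umans
arXiv:1207.6528 §5 (Sym^k compression is free in the group-theoretic framework), AlphaEvolve
arXiv:2506.13131 and DPS25 arXiv:2506.13242
(R(<4,4,4>) ≤ 48). Unlike route AsymptoticSpectrum (dual side: spectral points ≤ 4) and
AsymptoticRankCW (CW intermediate), this line
attacks R~(<2,2,2>) primally through an ansatz that is checkable at each N by a poly(N)-size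
algebraic system; no intermediate tensor,
no degeneration, no hashing. Negatives index empty at filing.

RANKED CRUXES. #0 EquivariantExponentTwo (target) — X as in § Thesis: ∀ ε > 0 ∃ N ≥ 1 ∃ r ≤
4^{(1+ε)N} and an S_N-equivariant decomposition of T_N = <2,2,2>^{⊠N} into r triads (card item
(1)+(4)). (why it might fail: full S_N-symmetry may cost an exponential factor even if ω = 2 (R^eq
is not visibly submultiplicative: D_N ⊠ D_M is only S_N×S_M-equivariant and symmetrising costs
C(N+M,N)); nothing published shows equivariance is free.) [arXiv:1801.00843, arXiv:1207.6528,
arXiv:1612.01527, LandsbergGCT2017]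
#2 SymmetrisationCheap (crux) — symmetrisation is asymptotically free for <2,2,2>: for every ε > 0
and all N ≥ N₀(ε) there is an S_N-equivariant decomposition of T_N with at most 2^{εN}·R(T_N) triads
(so R~^eq = R~ = 2^ω and X ⟺ ω = 2; the S_N-analogue of the generalized Comon question
LandsbergGCT2017 Q 4.1.4.2 / Conj 4.1.4.3, with subexponential slack). [difficulty: open-problem]
(why it might fail: exact symmetric optimality fails in general (Shitov's counterexample to Comon,
arXiv:1705.08740); the only general symmetriser is the orbit union, of cost [S_N : Stab D] up to N!;
rank is not convex, so no averaging argument is known.) [LandsbergGCT2017, arXiv:1801.00843,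
arXiv:1705.08740, arXiv:1207.6528]
#3 EquivariantSquare48 (crux) — N = 2 sign of life: <2,2,2>^{⊠2} (≅ <4,4,4>, S_2 = Kronecker swap =
simultaneous conjugation by the SWAP permutation matrix) has an S_2-equivariant decomposition into
48 triads over ℂ, i.e. R^eq_2 ≤ 48 < 49 = 7^2 (card item (3)). Equivalent (LandsbergGCT2017 Prop
4.1.2.2 + independence of the three isotropy slots): SOME rank-48 decomposition of <4,4,4> has a
stabiliser element in PSL±(4)^{×3} (trivial S_3-part) whose three matrices are each projectively a
reflection; first check the known stabiliser (C2×D4)⋊C2 of the AlphaEvolve/DPS25 scheme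
(arXiv:2506.13242 §3.1, generators (24)–(27)), then an orbit-flip-graph search with the symmetry
imposed. [difficulty: M] (why it might fail: every rank-48 decomposition of <4,4,4> may lack a
tri-reflection symmetry (the DPS25 generators b, d, a², bd, a²b, a²d are not of that type: first
slot has spectrum type (1,1,−1,−1)); R^eq_2 = 49 is consistent with everything known.)
[arXiv:2506.13242, arXiv:2506.13131, arXiv:2502.04514, arXiv:2503.05467, LandsbergGCT2017]
#4 EquivariantBeatsStrassenPower (crux) — for some N ≥ 1 there is an S_N-equivariant decomposition
of T_N with fewer than 7^N triads (R^eq_N < 7^N): the first N at which the equivariant ansatz does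
anything at all; implied by EquivariantSquare48, otherwise to be sought at N = 3, 4 with Young orbit
types (N), (N−1,1), (N−2,2), (N−2,1,1) inside the compressed system (card attack (a)). [difficulty:
M] (why it might fail: S_N-equivariance might be rigid at every finite N — all equivariant
decompositions of rank ≤ 7^N being Kronecker powers of the Strassen family up to isotropy (de Groote
transitivity for N = 1) — a striking but conceivable theorem.) [arXiv:1612.01527, arXiv:1408.6273,
arXiv:1610.08364, arXiv:2506.13242]
#5 EquivarianceCost (crux) — NEGATIVE SIDE (≈ ¬X, filed so refuters/provers can attack the line
directly): there is δ > 0 such that for every N ≥ 1 every S_N-equivariant decomposition of T_N has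
at least (4+δ)^N triads. Symmetry makes lower bounds tractable elsewhere (symmetric arithmetic
circuits, Dawar–Wilsenach arXiv:2002.06451, arXiv:2107.10986); the tool here would be orbit counting
/ representation stability of ((ℂ^4)^{⊗N})^{⊗3} under S_N × GL_4^3, not flattenings. [difficulty: L]
(why it might fail: X may simply be true; and any proof must avoid linear rank methods (capped at
6m−4 / 8n², Literature.Barriers.MatrixMultiplication.LinearRankMethodBarrier), since an equivariant
decomposition is in particular a decomposition.) [arXiv:2002.06451, arXiv:2107.10986,
arXiv:1710.09502, LandsbergGCT2017]
#9 StrassenPowerEquivariant (support) — calibration of the predicate: for every N the Kronecker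
power of Strassen's 7-term decomposition is an S_N-equivariant decomposition of T_N with 7^N triads
(R^eq_N ≤ 7^N). Provable now (index triads by Fin N → Fin 7 ≃ Fin (7^N); σ acts on labels by
precomposition). [difficulty: provable-now] [Strassen1969, Blaser2013]
#9 EquivariantRankBound (support) — glue for the assembly: an S_N-equivariant decomposition of T_N
into r triads gives R(<2^N,2^N,2^N>) ≤ r (forget equivariance; relabel T_N ≅ <2^N,2^N,2^N> by
tensorMonRestrictsTo_kroneckerPow_matMulTensor / kroneckerPow_matMulTensor_eq_comp, both proved).
[difficulty: provable-now] [AlmanDuanVassilevskaWilliamsXuXuZhou2025, Blaser2013]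

TWO-LAYER PLAN. Foreseen glued splits (nothing filed now): EquivariantExponentTwo ⇐ CompressionLemma
→ YoungFamily → EquivariantExponentTwo, where
CompressionLemma = "every S_N-equivariant decomposition of T_N with orbits of size ≤ 5^N is, for N ≥
N₀, a sum of orbit-sums of triads with
Young-type stabilisers (≤ 5 blocks, up to index poly(N))" (finite group theory: Liebeck–Praeger–Saxl
/ Maróti index bounds) and YoungFamily =
"for every ε an explicit family of Young-symmetric triads whose orbit-sums give T_N with ≤
4^{(1+ε)N} terms" (S_N × GL_4 representation theory);
EquivariantBeatsStrassenPower ⇐ N = 3 or N = 4 instances once EquivariantSquare48 is settled either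
way.

KILL CRITERIA. EquivarianceCost proved (any δ > 0) refutes EquivariantExponentTwo: close
`refuted:EquivariantExponentTwo` (card refuted; ω untouched — the census
records what symmetry costs). A proof that R^eq_N = 7^N for all N (¬EquivariantBeatsStrassenPower)
is the same kill in sharper form.
EquivariantSquare48 refuted alone (R^eq_2 = 49) is NOT a kill: pivot the computations to N = 3, 4.
SymmetrisationCheap refuted makes X strictly
stronger than ω = 2: keep the route only while EquivariantBeatsStrassenPower/EquivariantSquare48
give positive evidence, else close `exhausted`.
Any ω(ℂ) > 2 (route BorderRankLowerBound, NilCoxeterShadow) moots every positive route including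
this one; ω = 2 proved elsewhere moots it too.

NOT DECOMPOSED YET. The compression lemma (parametrisation of large-stabiliser triads and the
poly(N) evaluation map into Sym^N(ℂ^64) via monomial-symmetric
expansion) — a layer-2 child of the target; the structural YoungFamily construction (plethysm /
Kronecker-coefficient bookkeeping of the
three [λ]-factors); the N = 3, 4 searches; a named definition `equivariantRank` (sInf form of
R^eq_N) under Summits/…/Theorems, to be requested
at the first split (all statements are inlined today); monotonicity R^eq_N ≤ R^eq_{N+1} and the
coarse bound R^eq_{N+M} ≤ C(N+M,N) R^eq_N R^eq_M
(support lemmas a prover may attach with --supports); the question for general tensors with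
S_N-symmetric Kronecker powers (card item (4)).

CHEAPEST FALSIFIER. For crux 3/4: enumerate the known stabiliser (C2×D4)⋊C2 (order 32; full
stabiliser possibly larger, DPS25 Rem 3.1) of the <4,4,4>:48 scheme of
arXiv:2506.13131 / arXiv:2506.13242 and of every catalogued 48-scheme (fmm database,
arXiv:2606.13408, arXiv:2602.13171) and test for an element
(U,V,W) with all three matrices projectively reflections (|tr| = 2 in det ±1 normalisation, triple
eigenvalue) — a GAP job of minutes; a hit PROVES
EquivariantSquare48 and EquivariantBeatsStrassenPower by conjugation. By hand (this session) the
listed generators and six short words are not hits.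
For the whole line: an orbit-counting argument giving R^eq_N ≥ (4+δ)^N (EquivarianceCost); the
planner found none in an hour (flattening mass and
Schur–Weyl weight constraints are all consistent with balanced 4-part Young orbits of size ≈ 4^N
N^{-3/2}).

NUMBERS. R(<4,4,4>) ≤ 48 over ℂ (arXiv:2506.13131) and over ℚ, char ≠ 2 (arXiv:2506.13242); 49 = 7^2
= Strassen ⊠ Strassen (S_2-equivariant); R^eq_N ≤ 7^N,
standard algorithm 8^N (both equivariant); R(<n,n,n>) ≥ 3n^2 − o(n^2) (Landsberg 2014, as quoted in
route BorderRankLowerBound) and n^ω < R(<n,n,n>)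
(InfimumNotMinimumBarrier, proved exact cubic case), so 4^N < R(T_N) ≤ R^eq_N; ω(ℂ) < 2.371339
(AlmanDuanVassilevskaWilliamsXuXuZhou2025);
orbit budget [S_N : Stab] ≤ 4^{(1+ε)N}: balanced 4-block Young orbits have size C(N;
N/4,N/4,N/4,N/4) ≈ 4^N·(N^{-3/2} up to a constant), entropy
of admissible orbit types ≤ 2(1+ε) bits; invariant space dimension C(N+63,63). Items at open: 8 (1
target, 4 cruxes, 2 support, 1 assembly).

DEFINITION REQUESTS. None now: kroneckerPow, matMulTensor, triad, tensorRank
(Literature.Computability.AlgebraicComplexity) exist and the equivariance predicate is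
inlined (∀ σ ∃ π matching triads). Foreseen at first split: `equivariantRank` (sInf over r of the
inlined predicate) under
Summits/MatrixMultiplication/MatrixMultiplication/Theorems.

Novelty: Searches (2026-08-15): card's own searches (route files, CU13 pp. 12–15, lit frontier) re-read; `lit
frontier MatrixMultiplication --since 2023`
(30 rows: arXiv:2602.11041 structure in decompositions, arXiv:2606.13408 catalog, arXiv:2602.13171
complex-to-rational — fixed formats, no S_N
ansatz); `lit search --source s2 "flip graphs with symmetry matrix multiplication"` (10:
arXiv:2502.04514, arXiv:2503.05467 orbit flip graphs,
arXiv:2212.01175, arXiv:2511.20317, arXiv:2510.19787); `lit search --source zbmath` for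
Dawar–Wilsenach (2: arXiv:2002.06451, arXiv:2107.10986),
Shitov (arXiv:1705.08740), BILR (arXiv:1801.00843), Derksen G-stable rank (arXiv:2002.08435 —
different notion, name clash only);
`lit vsearch "rank decompositions of matrix multiplication invariant under a symmetry group"`
(LandsbergGCT2017 pp. 86–94 read: §4.1);
`lit read arxiv:2506.13242` (§3 stabilisers of the 48-scheme, read) and `lit read arxiv:1612.01527`
(§4 group-orbit constructions n^3−n+1);
`lit galaxy search "Flip Graphs with Symmetry" | "orbit flip graphs" | "symmetries of matrix
multiplication algorithms" --star all` (0 hits each);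
local searchd down and S2/arXiv/OpenAlex rate-limited during the session (noted in NOTES.md).
Nearest prior art found: decompositions with a PRESCRIBED finite symmetry for fixed formats — CILO
arXiv:1610.08364, BILR arXiv:1801.00843
(LandsbergGCT2017 Conj 4.1.4.3), Burichenko arXiv:1408.6273, Grochow–Moore arXiv:1612.01527,
Moosbauer–Poole arXiv:2502.04514, Ikenmeyer–Mo  [refs: 2602.11041, 2606.13408, 2602.13171, 2502.04514, 2503.05467, 2212.01175, 2511.20317, 2510.19787, 2002.06451, 2107.10986, 1705.08740, 1801.00843, 2002.08435, 2506.13242, 1612.01527, 1610.08364, 1408.6273, 1207.6528, arxiv:2506.13242, arxiv:1612.01527, LandsbergGCT2017]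

Barriers (technique_class: equivariant-decomposition, kronecker-power-symmetry): - technique_class: equivariant-decomposition, kronecker-power-symmetry
- Literature.Barriers.MatrixMultiplication.IrreversibilityBarrier: the only tensor powered is
<2,2,2> itself, listed there as tautologically unobstructed (evasions_known (iv), CVZ2021 §2.3:
2·i(<2,2,2>) = ω); no intermediate tensor t with i(t) > 1 appears.
- Literature.Barriers.MatrixMultiplication.UniversalMethodBarrier: not in the class — no fixed
non-matmul starting tensor, no (monomial) degeneration of powers of CW_q; the objects are honest
rank decompositions of <2^N,2^N,2^N>.
- Literature.Barriers.MatrixMultiplication.InfimumNotMinimumBarrier: respected, not evaded — each N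
certifies only ω ≤ (1/N) log_2 R^eq_N, which is > 2 by n^ω < R(<n,n,n>); X is a statement about a
sequence (one N per ε), never about one algorithm.
- Literature.Barriers.MatrixMultiplication.LinearRankMethodBarrier: bites only on the negative crux
EquivarianceCost if one tried flattenings (cap 6m−4 / 8n^2); the intended tool there is orbit
counting under S_N, outside the determinantal class; it does not touch the positive cruxes.
- Literature.Barriers.MatrixMultiplication.YoungSubgroupBarrier: shares only the words "Young
subgroup" (there: TPP triples of Young subgroups in ℂ[S_n]); here Young subgroups are stabilisers of
triads of a decomposition of <2^N>; not applicable.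
- Negatives index: empty at filing (ledger negatives --problem MatrixMultiplication: 0 refuted
statements, 2026-08-15).

Novelty grade: new-combination — refuter route-review g2 (2026-08-15). Object = rank decompositions of <2^N,2^N,2^N> = <2,2,2>^{⊠N} that are unions of orbits of the finite group S_N < diagonal PGL_{2^N} (qubit permutations, simultaneous conjugation): this is the Grochow–Moore 'algorithms from group orbits' ansatz (arXiv:1612.01527, (refuter refuter-rreview-route-MatrixMultiplicati-dce50ba7-g2-0, 2026-08-15T14:48:46Z; prior: arXiv:1612.01527, arXiv:1708.09398, arXiv:1909.04785, arXiv:1709.07851, arXiv:1801.00843, arXiv:2506.13242, LandsbergGCT2017 §4.1)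

History (route lifecycle, newest last):
- 2026-08-16T04:11:15Z · AUTO-CRUX (backfill): EquivariantExponentTwo — hypotheses of the deciding theorem that nothing in the route derives are cruxes (operator:999:1085951)
- 2026-08-22T03:34:30Z · DORMANT — reconciler: no traction for 5 d (last activity item-evidence-added at 2026-08-17T02:17:15Z); parked, not closed — `ledger route dormant route-MatrixMultiplicati (operator:999:651471)

sub-problem: MatrixMultiplication · status: dormant · opened planner-plancard-MatrixMultiplication-MatrixM-df52d2c0-0 2026-08-15T11:19:52Z · rev 1 · ledger route-MatrixMultiplication-SchurWeylEquivariant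
GENERATED by the gate from the ledger (D-0016/17). Provers cite these decls: `theorem foo : Summit.MatrixMultiplication.MatrixMultiplication.Theses.SchurWeylEquivariant.<Decl> := …` in Summits/MatrixMultiplication/MatrixMultiplication/Theorems/<Name>.lean.
-/

namespace Summit.MatrixMultiplication.MatrixMultiplication.Theses.SchurWeylEquivariant

open scoped BigOperators Topology Manifold Classical MeasureTheory ProbabilityTheory Matrix InnerProductSpace ComplexConjugate ContinuousMap
open Filter Set Function TopologicalSpace MeasureTheory

attribute [summit_statement] _root_.MatrixMultiplication

/-- item stmt-MatrixMultiplication-3550 · crux (kind.auto-crux: conjecture-grade) · rank 0 · open · by planner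
why it might fail: full S_N-symmetry may cost an exponential factor even if ω = 2 (R^eq is not visibly submultiplicative: D_N ⊠ D_M is only S_N×S_M-equivariant and symmetrising costs C(N+M,N)); nothing published shows equivariance is free.
sources: arXiv:1801.00843, arXiv:1207.6528, arXiv:1612.01527, LandsbergGCT2017
[target] X as in § Thesis: ∀ ε > 0 ∃ N ≥ 1 ∃ r ≤ 4^{(1+ε)N} and an S_N-equivariant decomposition of
T_N = <2,2,2>^{⊠N} into r triads (card item (1)+(4)). -/
@[route_item "route-MatrixMultiplication-SchurWeylEquivariant", crux]
def EquivariantExponentTwo : Prop :=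
  ∀ ε : ℝ, 0 < ε → ∃ N : ℕ, 1 ≤ N ∧ ∃ r : ℕ, (r : ℝ) ≤ (4 : ℝ) ^ ((1 + ε) * N) ∧ ∃ (w u v : Fin r → (Fin N → Fin 2 × Fin 2) → ℂ), Literature.Computability.AlgebraicComplexity.kroneckerPow (Literature.Computability.AlgebraicComplexity.matMulTensor ℂ 2 2 2) N = ∑ j, Literature.Computability.AlgebraicComplexity.triad (w j) (u j) (v j) ∧ ∀ σ : Equiv.Perm (Fin N), ∃ π : Equiv.Perm (Fin r), ∀ j, Literature.Computability.AlgebraicComplexity.triad (w (π j)) (u (π j)) (v (π j)) = fun a b c => Literature.Computability.AlgebraicComplexity.triad (w j) (u j) (v j) (a ∘ σ) (b ∘ σ) (c ∘ σ)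

/-- item stmt-MatrixMultiplication-3551 · crux · rank 2 · open · by planner
why it might fail: exact symmetric optimality fails in general (Shitov's counterexample to Comon, arXiv:1705.08740); the only general symmetriser is the orbit union, of cost [S_N : Stab D] up to N!; rank is not convex, so no averaging argument is known.
sources: LandsbergGCT2017, arXiv:1801.00843, arXiv:1705.08740, arXiv:1207.6528
[crux] symmetrisation is asymptotically free for <2,2,2>: for every ε > 0 and all N ≥ N₀(ε) there is
an S_N-equivariant decomposition of T_N with at most 2^{εN}·R(T_N) triads (so R~^eq = R~ = 2^ω and X
⟺ ω = 2; the S_N-analogue of the generalized Comon question LandsbergGCT2017 Q 4.1.4.2 / Conj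
4.1.4.3, with subexponential slack). [difficulty: open-problem] -/
@[route_item "route-MatrixMultiplication-SchurWeylEquivariant"]
def SymmetrisationCheap : Prop :=
  ∀ ε : ℝ, 0 < ε → ∃ N₀ : ℕ, ∀ N : ℕ, N₀ ≤ N → ∃ r : ℕ, (r : ℝ) ≤ (2 : ℝ) ^ (ε * N) * (Literature.Computability.AlgebraicComplexity.tensorRank (Literature.Computability.AlgebraicComplexity.kroneckerPow (Literature.Computability.AlgebraicComplexity.matMulTensor ℂ 2 2 2) N) : ℝ) ∧ ∃ (w u v : Fin r → (Fin N → Fin 2 × Fin 2) → ℂ), Literature.Computability.AlgebraicComplexity.kroneckerPow (Literature.Computability.AlgebraicComplexity.matMulTensor ℂ 2 2 2) N = ∑ j, Literature.Computability.AlgebraicComplexity.triad (w j) (u j) (v j) ∧ ∀ σ : Equiv.Perm (Fin N), ∃ π : Equiv.Perm (Fin r), ∀ j, Literature.Computability.AlgebraicComplexity.triad (w (π j)) (u (π j)) (v (π j)) = fun a b c => Literature.Computability.AlgebraicComplexity.triad (w j) (u j) (v j) (a ∘ σ) (b ∘ σ) (c ∘ σ)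

/-- item stmt-MatrixMultiplication-3552 · crux · rank 3 · open · by planner
why it might fail: every rank-48 decomposition of <4,4,4> may lack a tri-reflection symmetry (the DPS25 generators b, d, a², bd, a²b, a²d are not of that type: first slot has spectrum type (1,1,−1,−1)); R^eq_2 = 49 is consistent with everything known.
sources: arXiv:2506.13242, arXiv:2506.13131, arXiv:2502.04514, arXiv:2503.05467, LandsbergGCT2017
[crux] N = 2 sign of life: <2,2,2>^{⊠2} (≅ <4,4,4>, S_2 = Kronecker swap = simultaneous conjugation
by the SWAP permutation matrix) has an S_2-equivariant decomposition into 48 triads over ℂ, i.e.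
R^eq_2 ≤ 48 < 49 = 7^2 (card item (3)). Equivalent (LandsbergGCT2017 Prop 4.1.2.2 + independence of
the three isotropy slots): SOME rank-48 decomposition of <4,4,4> has a stabiliser element in
PSL±(4)^{×3} (trivial S_3-part) whose three matrices are each projectively a reflection; first check
the known stabiliser (C2×D4)⋊C2 of the AlphaEvolve/DPS25 scheme (arXiv:2506.13242 §3.1, generators
(24)–(27)), then an orbit-flip-graph search with the symmetry imposed. [difficulty: M] -/
@[route_item "route-MatrixMultiplication-SchurWeylEquivariant"]
def EquivariantSquare48 : Prop :=
  ∃ (w u v : Fin 48 → (Fin 2 → Fin 2 × Fin 2) → ℂ), Literature.Computability.AlgebraicComplexity.kroneckerPow (Literature.Computability.AlgebraicComplexity.matMulTensor ℂ 2 2 2) 2 = ∑ j, Literature.Computability.AlgebraicComplexity.triad (w j) (u j) (v j) ∧ ∀ σ : Equiv.Perm (Fin 2), ∃ π : Equiv.Perm (Fin 48), ∀ j, Literature.Computability.AlgebraicComplexity.triad (w (π j)) (u (π j)) (v (π j)) = fun a b c => Literature.Computability.AlgebraicComplexity.triad (w j) (u j) (v j) (a ∘ σ) (b ∘ σ) (c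 ∘ σ)

/-- item stmt-MatrixMultiplication-3553 · crux · rank 4 · open · by planner
why it might fail: S_N-equivariance might be rigid at every finite N — all equivariant decompositions of rank ≤ 7^N being Kronecker powers of the Strassen family up to isotropy (de Groote transitivity for N = 1) — a striking but conceivable theorem.
sources: arXiv:1612.01527, arXiv:1408.6273, arXiv:1610.08364, arXiv:2506.13242
[crux] for some N ≥ 1 there is an S_N-equivariant decomposition of T_N with fewer than 7^N triads
(R^eq_N < 7^N): the first N at which the equivariant ansatz does anything at all; implied by
EquivariantSquare48, otherwise to be sought at N = 3, 4 with Young orbit types (N), (N−1,1),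
(N−2,2), (N−2,1,1) inside the compressed system (card attack (a)). [difficulty: M] -/
@[route_item "route-MatrixMultiplication-SchurWeylEquivariant"]
def EquivariantBeatsStrassenPower : Prop :=
  ∃ N : ℕ, 1 ≤ N ∧ ∃ r : ℕ, r < 7 ^ N ∧ ∃ (w u v : Fin r → (Fin N → Fin 2 × Fin 2) → ℂ), Literature.Computability.AlgebraicComplexity.kroneckerPow (Literature.Computability.AlgebraicComplexity.matMulTensor ℂ 2 2 2) N = ∑ j, Literature.Computability.AlgebraicComplexity.triad (w j) (u j) (v j) ∧ ∀ σ : Equiv.Perm (Fin N), ∃ π : Equiv.Perm (Fin r), ∀ j, Literature.Computability.AlgebraicComplexity.triad (w (π j)) (u (π j)) (v (π j)) = fun a b c => Literature.Computability.AlgebraicComplexity.triad (w j) (u j) (v j) (a ∘ σ) (b ∘ σ) (c ∘ σ)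

/-- item stmt-MatrixMultiplication-3554 · crux · rank 5 · open · by planner
why it might fail: X may simply be true; and any proof must avoid linear rank methods (capped at 6m−4 / 8n², Literature.Barriers.MatrixMultiplication.LinearRankMethodBarrier), since an equivariant decomposition is in particular a decomposition.
sources: arXiv:2002.06451, arXiv:2107.10986, arXiv:1710.09502, LandsbergGCT2017
[crux] NEGATIVE SIDE (≈ ¬X, filed so refuters/provers can attack the line directly): there is δ > 0
such that for every N ≥ 1 every S_N-equivariant decomposition of T_N has at least (4+δ)^N triads.
Symmetry makes lower bounds tractable elsewhere (symmetric arithmetic circuits, Dawar–Wilsenach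
arXiv:2002.06451, arXiv:2107.10986); the tool here would be orbit counting / representation
stability of ((ℂ^4)^{⊗N})^{⊗3} under S_N × GL_4^3, not flattenings. [difficulty: L] -/
@[route_item "route-MatrixMultiplication-SchurWeylEquivariant"]
def EquivarianceCost : Prop :=
  ∃ δ : ℝ, 0 < δ ∧ ∀ N : ℕ, 1 ≤ N → ∀ r : ℕ, (∃ (w u v : Fin r → (Fin N → Fin 2 × Fin 2) → ℂ), Literature.Computability.AlgebraicComplexity.kroneckerPow (Literature.Computability.AlgebraicComplexity.matMulTensor ℂ 2 2 2) N = ∑ j, Literature.Computability.AlgebraicComplexity.triad (w j) (u j) (v j) ∧ ∀ σ : Equiv.Perm (Fin N), ∃ π : Equiv.Perm (Fin r), ∀ j, Literature.Computability.AlgebraicComplexity.triad (w (π j)) (u (π j)) (v (π j)) = fun a b c => Literature.Computability.AlgebraicComplexity.triad (w j) (u j) (v j) (a ∘ σ) (b ∘ σ) (c ∘ σ)) → ((4 : ℝ) + δ) ^ N ≤ (r : ℝ)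

/-- item stmt-MatrixMultiplication-3555 · support · rank 9 · closed · proved by Summit.MatrixMultiplication.MatrixMultiplication.Theorems.strassenPowerEquivariant_proof @ 080e58746066 (prover) · by planner
sources: Strassen1969, Blaser2013
[support] calibration of the predicate: for every N the Kronecker power of Strassen's 7-term
decomposition is an S_N-equivariant decomposition of T_N with 7^N triads (R^eq_N ≤ 7^N). Provable
now (index triads by Fin N → Fin 7 ≃ Fin (7^N); σ acts on labels by precomposition). [difficulty:
provable-now] -/
@[route_item "route-MatrixMultiplication-SchurWeylEquivariant"]
def StrassenPowerEquivariant : Prop :=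
  ∀ N : ℕ, ∃ (w u v : Fin (7 ^ N) → (Fin N → Fin 2 × Fin 2) → ℂ), Literature.Computability.AlgebraicComplexity.kroneckerPow (Literature.Computability.AlgebraicComplexity.matMulTensor ℂ 2 2 2) N = ∑ j, Literature.Computability.AlgebraicComplexity.triad (w j) (u j) (v j) ∧ ∀ σ : Equiv.Perm (Fin N), ∃ π : Equiv.Perm (Fin (7 ^ N)), ∀ j, Literature.Computability.AlgebraicComplexity.triad (w (π j)) (u (π j)) (v (π j)) = fun a b c => Literature.Computability.AlgebraicComplexity.triad (w j) (u j) (v j) (a ∘ σ) (b ∘ σ) (c ∘ σ)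

/-- item stmt-MatrixMultiplication-3556 · support · rank 9 · closed · proved by Summit.MatrixMultiplication.MatrixMultiplication.Theorems.equivariantRankBound_proof @ 0cd248dbd2fe (prover) · by planner
sources: AlmanDuanVassilevskaWilliamsXuXuZhou2025, Blaser2013
[support] glue for the assembly: an S_N-equivariant decomposition of T_N into r triads gives
R(<2^N,2^N,2^N>) ≤ r (forget equivariance; relabel T_N ≅ <2^N,2^N,2^N> by
tensorMonRestrictsTo_kroneckerPow_matMulTensor / kroneckerPow_matMulTensor_eq_comp, both proved).
[difficulty: provable-now] -/
@[route_item "route-MatrixMultiplication-SchurWeylEquivariant"]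
def EquivariantRankBound : Prop :=
  ∀ N r : ℕ, (∃ (w u v : Fin r → (Fin N → Fin 2 × Fin 2) → ℂ), Literature.Computability.AlgebraicComplexity.kroneckerPow (Literature.Computability.AlgebraicComplexity.matMulTensor ℂ 2 2 2) N = ∑ j, Literature.Computability.AlgebraicComplexity.triad (w j) (u j) (v j) ∧ ∀ σ : Equiv.Perm (Fin N), ∃ π : Equiv.Perm (Fin r), ∀ j, Literature.Computability.AlgebraicComplexity.triad (w (π j)) (u (π j)) (v (π j)) = fun a b c => Literature.Computability.AlgebraicComplexity.triad (w j) (u j) (v j) (a ∘ σ) (b ∘ σ) (c ∘ σ)) → Literature.Computability.AlgebraicComplexity.tensorRank (Literature.Computability.AlgebraicComplexity.matMulTensor ℂ (2 ^ N) (2 ^ N) (2 ^ N)) ≤ r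

/-- item stmt-MatrixMultiplication-3557 · assembly · rank 1 · closed · proved by Summit.MatrixMultiplication.MatrixMultiplication.Theorems.schurWeylEquivariant_assembly_proof @ cdab78711d30 (prover) · by planner
sources: Blaser2013, AlmanDuanVassilevskaWilliamsXuXuZhou2025
[assembly] EquivariantExponentTwo → MatrixMultiplication (ω(ℂ) = 2). -/
@[route_item "route-MatrixMultiplication-SchurWeylEquivariant"]
def Assembly : Prop :=
  EquivariantExponentTwo → MatrixMultiplication

/-! D-0027 §2.1 — DECIDING THEOREM (planner-authored via `route open/edit --closes-file`; by planner-rbadge-MatrixMultiplication-SchurWeylE-4715023c-g2-0 2026-08-15T16:16:55Z):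
its hypotheses are this route's items and its conclusion the sub-problem Statement (glue_lint), and it elaborates with this file. -/

@[closes "route-MatrixMultiplication-SchurWeylEquivariant"] theorem closes (hX : EquivariantExponentTwo) : MatrixMultiplication := by
  -- `MatrixMultiplication` is by definition `ω(ℂ) = 2`; `2 ≤ ω(ℂ)` is the flattening bound.
  show Literature.Computability.AlgebraicComplexity.omega ℂ = 2
  refine le_antisymm ?_ (Literature.Computability.AlgebraicComplexity.omega_two_le ℂ)
  refine le_of_forall_pos_le_add fun δ hδ => ?_
  -- X at `ε = δ/2`: some `N ≥ 1`, `r ≤ 4^{(1+δ/2)N}` and an (equivariant) decomposition of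
  -- `⟨2,2,2⟩^{⊠N}` into `r` triads; equivariance is forgotten.
  obtain ⟨N, hN, r, hr, w, u, v, hdec, -⟩ := hX (δ / 2) (by positivity)
  -- Step 1. `R(⟨2^N,2^N,2^N⟩) ≤ r`: `⟨2^N,2^N,2^N⟩` is `⟨2,2,2⟩^{⊠N}` read along the base-2 digit maps.
  have hrank : Literature.Computability.AlgebraicComplexity.tensorRank
      (Literature.Computability.AlgebraicComplexity.matMulTensor ℂ (2 ^ N) (2 ^ N) (2 ^ N)) ≤ r := by
    obtain ⟨e, he⟩ : ∃ e : Fin (2 ^ N) × Fin (2 ^ N) → (Fin N → Fin 2 × Fin 2),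
        ∀ p, e p = fun i => ((finFunctionFinEquiv.symm p.1) i, (finFunctionFinEquiv.symm p.2) i) :=
      ⟨_, fun _ => rfl⟩
    have key : Literature.Computability.AlgebraicComplexity.matMulTensor ℂ (2 ^ N) (2 ^ N) (2 ^ N) =
        fun a b c => Literature.Computability.AlgebraicComplexity.kroneckerPow
          (Literature.Computability.AlgebraicComplexity.matMulTensor ℂ 2 2 2) N (e a) (e b) (e c) := by
      funext a b c
      simp only [Literature.Computability.AlgebraicComplexity.kroneckerPow_apply,
        Literature.Computability.AlgebraicComplexity.matMulTensor, he]
      by_cases h : a.1 = b.1 ∧ b.2 = c.1 ∧ a.2 = c.2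
      · rw [if_pos h]
        obtain ⟨h1, h2, h3⟩ := h
        symm
        refine Finset.prod_eq_one fun i _ => ?_
        rw [if_pos ⟨by rw [h1], by rw [h2], by rw [h3]⟩]
      · rw [if_neg h]
        symm
        have hex : ∃ i, ¬ ((finFunctionFinEquiv.symm a.1) i = (finFunctionFinEquiv.symm b.1) i ∧
            (finFunctionFinEquiv.symm b.2) i = (finFunctionFinEquiv.symm c.1) i ∧
            (finFunctionFinEquiv.symm a.2) i = (finFunctionFinEquiv.symm c.2) i) := by
          by_contra hall
          push Not at hall
          refine h ⟨?_, ?_, ?_⟩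
          · exact finFunctionFinEquiv.symm.injective (funext fun i => (hall i).1)
          · exact finFunctionFinEquiv.symm.injective (funext fun i => (hall i).2.1)
          · exact finFunctionFinEquiv.symm.injective (funext fun i => (hall i).2.2)
        obtain ⟨i, hi⟩ := hex
        exact Finset.prod_eq_zero (Finset.mem_univ i) (if_neg hi)
    rw [key, hdec]
    refine Literature.Computability.AlgebraicComplexity.tensorRank_le_of_eq_sum
      (fun j a => w j (e a)) (fun j b => u j (e b)) (fun j c => v j (e c)) ?_
    funext a b c
    rw [Literature.Computability.AlgebraicComplexity.sum_triad_apply,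
      Literature.Computability.AlgebraicComplexity.sum_triad_apply]
  -- Step 2. Bläser 2013, Thm 5.9 (cubic form): `R(⟨q,q,q⟩) ≤ r`, `q = 2^N ≥ 2` ⇒ `ω ≤ log_q r`.
  have hq : 2 ≤ 2 ^ N :=
    calc 2 = 2 ^ 1 := (pow_one 2).symm
      _ ≤ 2 ^ N := Nat.pow_le_pow_right (by norm_num) hN
  have hω := Literature.Computability.AlgebraicComplexity.omega_le_logb_of_rank_le'
    Literature.Computability.AlgebraicComplexity.Blaser2013Thm59_holds ℂ hq hrank
  refine hω.trans ?_
  -- Step 3. `log_{2^N} r ≤ 2 + δ` because `r ≤ 4^{(1+δ/2)N} = (2^N)^{2+δ}`.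
  have hq1 : (1 : ℝ) < ((2 ^ N : ℕ) : ℝ) := by exact_mod_cast lt_of_lt_of_le (by norm_num) hq
  have hq0 : (0 : ℝ) < ((2 ^ N : ℕ) : ℝ) := lt_trans zero_lt_one hq1
  have h4 : (4 : ℝ) ^ ((1 + δ / 2) * (N : ℝ)) = ((2 ^ N : ℕ) : ℝ) ^ (2 + δ) := by
    rw [show (4 : ℝ) = (2 : ℝ) ^ (2 : ℝ) by norm_num, ← Real.rpow_mul (by norm_num), Nat.cast_pow,
      Nat.cast_ofNat, ← Real.rpow_natCast, ← Real.rpow_mul (by norm_num)]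
    congr 1
    ring
  rcases Nat.eq_zero_or_pos r with hr0 | hrpos
  · subst hr0
    rw [Nat.cast_zero, Real.logb_zero]
    linarith
  · have hrpos' : (0 : ℝ) < (r : ℝ) := by exact_mod_cast hrpos
    have hle : (r : ℝ) ≤ ((2 ^ N : ℕ) : ℝ) ^ (2 + δ) := by rw [← h4]; exact hr
    calc Real.logb ((2 ^ N : ℕ) : ℝ) (r : ℝ)
        ≤ Real.logb ((2 ^ N : ℕ) : ℝ) (((2 ^ N : ℕ) : ℝ) ^ (2 + δ)) :=
          Real.logb_le_logb_of_le hq1 hrpos' hle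
      _ = 2 + δ := Real.logb_rpow hq0 hq1.ne'

end Summit.MatrixMultiplication.MatrixMultiplication.Theses.SchurWeylEquivariant
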